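import Summits.Ventures.PercRepro.MSTightProj

/-!
# Lost differences: removing a subfamily `M` from a family `T`

Dossier proofs/MINE1-theoremS.md, Addendum 48 §6 (the lost-difference calculus). For families
`T` and `M` of finite sets, a difference `w` of `T` is **lost** when `M` is removed if every pair
`(a, b)` of members of `T` with `a \ b = w` meets `M`. Then the differences of `T \ M` are exactly
the differences of `T` that are not lost (`diffs_sdiff_eq_diffs_sdiff_lost`), so
`|(T \ M) \\ (T \ M)| + |lost T M| = |T \\ T|` (`card_diffs_sdiff_add_card_lost`), and for a TIGHT
`T` and `M ⊆ T` the Marica–Schönheim inequality for `T \ M` gives `|lost T M| ≤ |M|`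
(`card_lost_le_of_tight`) with the excess of `T \ M` equal to `|M| - |lost T M|`
(`card_diffs_sdiff_eq_of_tight`). In particular `T \ M` has excess one iff exactly `|M| - 1`
differences are lost — the form in which the excess-one condition at a tightening direction is
analysed in Addendum 48 (`T = F̂`, `M = P₁`).
-/

namespace PercRepro.MSTight

open Finset
open scoped FinsetFamily

variable {α : Type*} [DecidableEq α]

/-- The differences of `T` **lost** when `M` is removed: those all of whose realising pairs of
members of `T` meet `M`. -/
def lost (T M : Finset (Finset α)) : Finset (Finset α) :=
  (T \\ T).filter fun w => ∀ a ∈ T, ∀ b ∈ T, a \ b = w → a ∈ M ∨ b ∈ M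

/-- Membership in `lost T M`: a difference of `T` all of whose realising pairs meet `M`. -/
theorem mem_lost {T M : Finset (Finset α)} {w : Finset α} :
    w ∈ lost T M ↔ w ∈ T \\ T ∧ ∀ a ∈ T, ∀ b ∈ T, a \ b = w → a ∈ M ∨ b ∈ M := by
  unfold lost
  exact mem_filter

/-- Lost differences are differences of `T`. -/
theorem lost_subset_diffs (T M : Finset (Finset α)) : lost T M ⊆ T \\ T :=
  filter_subset _ _

/-- The differences of `T \ M` are the differences of `T` that are not lost. -/
theorem diffs_sdiff_eq_diffs_sdiff_lost (T M : Finset (Finset α)) :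
    (T \ M) \\ (T \ M) = (T \\ T) \ lost T M := by
  ext w
  simp only [mem_diffs, mem_sdiff, mem_lost, not_and, not_forall, exists_prop]
  constructor
  · rintro ⟨a, ⟨haT, haM⟩, b, ⟨hbT, hbM⟩, rfl⟩
    refine ⟨⟨a, haT, b, hbT, rfl⟩, fun _ => ⟨a, haT, b, hbT, rfl, ?_⟩⟩
    rintro (h | h)
    · exact haM h
    · exact hbM h
  · rintro ⟨hw, h⟩
    obtain ⟨a, haT, b, hbT, hab, hM⟩ := h hw
    exact ⟨a, ⟨haT, fun h => hM (Or.inl h)⟩, b, ⟨hbT, fun h => hM (Or.inr h)⟩, hab⟩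

/-- `|D(T \ M)| + |lost T M| = |D(T)|`. -/
theorem card_diffs_sdiff_add_card_lost (T M : Finset (Finset α)) :
    ((T \ M) \\ (T \ M)).card + (lost T M).card = (T \\ T).card := by
  rw [diffs_sdiff_eq_diffs_sdiff_lost]
  exact card_sdiff_add_card_eq_card (lost_subset_diffs T M)

/-- For a tight `T` and `M ⊆ T`, at most `|M|` differences are lost (Marica–Schönheim for
`T \ M`). -/
theorem card_lost_le_of_tight {T M : Finset (Finset α)} (hT : Tight T) (hM : M ⊆ T) :
    (lost T M).card ≤ M.card := by
  have h1 := card_diffs_sdiff_add_card_lost T M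
  have h2 := card_le_card_diffs (T \ M)
  have h3 := card_sdiff_add_card_eq_card hM
  unfold Tight at hT
  omega

/-- For a tight `T` and `M ⊆ T`, the excess of `T \ M` is `|M| - |lost T M|`:
`|D(T \ M)| = |T \ M| + (|M| - |lost T M|)`. -/
theorem card_diffs_sdiff_eq_of_tight {T M : Finset (Finset α)} (hT : Tight T) (hM : M ⊆ T) :
    ((T \ M) \\ (T \ M)).card = (T \ M).card + (M.card - (lost T M).card) := by
  have h1 := card_diffs_sdiff_add_card_lost T M
  have h3 := card_sdiff_add_card_eq_card hM
  have h4 := card_lost_le_of_tight hT hM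
  unfold Tight at hT
  omega

/-- `T \ M` has excess one iff exactly `|M| - 1` differences of the tight `T` are lost. -/
theorem card_diffs_sdiff_eq_succ_iff_of_tight {T M : Finset (Finset α)} (hT : Tight T)
    (hM : M ⊆ T) :
    ((T \ M) \\ (T \ M)).card = (T \ M).card + 1 ↔ (lost T M).card + 1 = M.card := by
  have h := card_diffs_sdiff_eq_of_tight hT hM
  have h4 := card_lost_le_of_tight hT hM
  omega

end PercRepro.MSTight
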